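/-
Copyright (c) 2026 the pub-hodgecm-mathlib formalisation cell (harness21).  Prover seat hodgecm-mathlib-K2E2-p03 (g0),
Track B «K2-LIT» ∕ h413 (stmt-HodgeConjecture-24833), line K2_E2 «ThetaExhaustionByRigidity», unit ORIENT, socket #18 (OR-2, closer) — FILE 4∕4:
payment of `Orient.sig_K2E2OrAntiholWitnessOfNeg` = tier-0 `StubAntiholWitnessOfNeg` — A NEGATIVELY ORIENTED ADMISSIBLE WEIGHT-ONE LABEL HAS AN
ANTIHOLOMORPHIC-COTANGENT DISCRETE CARRIER.  2026-09-03.  KERNEL module: THEOREMS ONLY (no definition, no named fact, no `sorry`, no instance, no notation).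
-/
import Summits.HodgeConjecture.HodgeConjecture.Theorems.K2E2ThetaOccursInGenAntihol         -- file 3∕4: `thetaOccursInGenAntihol_of_not_mem` (Θ-OCC-GEN, antiholomorphic values at `ι ∉ Φ_μ`)
import Summits.HodgeConjecture.HodgeConjecture.Theorems.K2E2OccOrientedOfOccursIn          -- ★ K2E2-p12 (H1): `exists_isAntiholCotangentAt_hasFinComponent_of_occursIn_antihol_cm`
import Summits.HodgeConjecture.HodgeConjecture.Theorems.F0P2cStubCI                        -- ★ `rhoAtLine_chi_isIrreducible` ([Liu2021, Lem. D.1])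
import Summits.HodgeConjecture.HodgeConjecture.Theorems.F0P2cSocketC                       -- ★ (C♭) frame currency (socket statement vocabulary)
import Literature.NumberTheory.Automorphic.Liu2021.CohHolMeetsThetaLiftFromLine            -- ★ letter #113 frame vocabulary (pinned `ιA`: `UnitaryGroup.adelic`, `adelicVal`, `toAdeleGL`)
import Literature.NumberTheory.Automorphic.Liu2021.ThetaLiftFromLineCoinvariantJunction    -- ★ pinned transports (socket statement vocabulary)
import HarnessLib

/-!
# K2_E2 road (h413 = stmt-HodgeConjecture-24833), unit ORIENT, socket #18 (OR-2, closer) — file 4∕4: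
# at a NEGATIVELY oriented place (`ι ∉ Φ_μ`) the admissible weight-one label `(μ, ⟨a⟩, χ)` has an ANTIHOLOMORPHIC-cotangent discrete carrier

Cell `pub/hodgecm-mathlib` (D-0151), Track B (21-frontier RULING «PUSH BOTH» 2026-09-03, director req621∕req624, chair K2-lead, dealer K2E2-plan
R8 RE-CUT 2026-09-03T21:42Z), socket module `Summits/HodgeConjecture/HodgeConjecture/Cruxes/H413/Lines/K2_E2_ThetaExhaustionByRigidity_Orient.lean`
(ED. 1 06414bc3f9e6e690 ∕ ED. 2 fd354df2d3b8 — #18 bytes frozen), socket **`sig_K2E2OrAntiholWitnessOfNeg`** (= tier-0 `StubAntiholWitnessOfNeg` of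
`K2_E2_ThetaExhaustionByRigidity.lean` ED. 4∕5 VERBATIM): for a CM frame `(L, ι, H, T)` (`Tᴴ H^ι T = J`, `H` definite off the place of `ι`, `[L⁺:ℚ] ≥ 2`), a
rational frame `(e₁, dV, g, ιV)` of `H ≅ diag dV` (and the pinned archimedean transport `ιA`, unused here), an automorphic measure `μA`, a conjugate-symplectic
`μ` OF WEIGHT ONE whose CM type does NOT contain `ι`, and a line `a ∈ (L⁺)ˣ` with `a·(2δ_L)⁻¹` `Φ_μ`-admissible: some discrete automorphic `P″ ≤ L²(μA)` of
`U(H)` is ANTIHOLOMORPHIC-cotangent at `(cmArchSection T, cmCompactFactor T)` and has finite component `ω_H(μ, a, χ)[ιV]` (`rhoAtLine … ιV a χ`).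

THE MATHEMATICS ([Liu2021, proof of Prop. 4.13 and App. D Lem. D.1 (2), D.2 (2)]; the dealer's ∕ K2E2-r01's STANDALONE road in abstract currency — no
theta FUNCTION, no socket #17∕#17R, no socket #12R): the admissibility of `a·(2δ_L)⁻¹` IS the collection hypothesis of Θ-OCC-GEN with `e := a·(2δ_L)⁻¹` (★
`Def411WeilCarriers.epsOf_algebraMap_mul`: `epsOf (2δ)⁻¹ (a·(2δ)⁻¹) = locF a`); file 3∕4 `thetaOccursInGenAntihol_of_not_mem` gives a non-zero
`ρ(a,χ)`-equivariant `θ` from `ω_H(μ,a,χ)[ιV]` into the ANTIHOLOMORPHIC cotangent forms at `(cmArchSection T, cmCompactFactor T)`; `ρ(a,χ)` is irreducible (★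
`F0P2cStubCI.rhoAtLine_chi_isIrreducible`, [Liu2021, Lem. D.1]); and ★ K2E2-p12's antiholomorphic receiver
`K2E2OccOrientedOfOccursIn.exists_isAntiholCotangentAt_hasFinComponent_of_occursIn_antihol_cm` ((D̄) ★ `antiholCotFormSpectralProjection_of_hol` + J1′ ★
`exists_discreteAutomorphicRep_of_equivariant_cohForms`, at the GIVEN measure `μA`) yields the discrete automorphic `P″` — `IsAntiholCotangentAt` with
`HasFinComponent ρ(a,χ)`.  §7 **`orAntiholWitnessOfNeg`** is the socket TOKEN FOR TOKEN (statement bytes pasted from the socket module).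
No hypothesis of substance is idle: `ι ∉ Φ_μ` selects the antiholomorphic orientation (for `ι ∈ Φ_μ` the carrier is holomorphic, socket #12R), weight one and
admissibility feed the theta engine, `hpos`∕`2 ≤ [L⁺:ℚ]` give the compact quotient and anisotropy; `ιA` and `[CompactSpace …]` are decoration inherited from the
tier-0 frame (the conclusion does not mention `ιA`; compactness follows from `hpos`).

HONEST LABEL: HC_CM is proved only modulo the 7 printed citations (2 remaining named inputs: hLiu418 = stmt-HodgeConjecture-24832,
h413 = stmt-HodgeConjecture-24833) until rung 0 closes; this file is a `--supports stmt-HodgeConjecture-24833` helper (it pays socket #18 = tier-0 stub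
`stub_antiholWitnessOfNeg` of the K2_E2 road, consumed BY NAME by the line's head B) and discharges no printed citation by itself — kernel glue over ★ rows.

## References
* [Liu2021] Y. Liu, *Fourier–Jacobi cycles and arithmetic relative trace formula*, Camb. J. Math. 9 (2021) = arXiv:2102.11518: proof of Prop. 4.13
  (Case 1, l. 2129–2137; «Conversely» l. 2145–2149); Def. 4.11–4.12; App. D §D.1 Steps 1–3, Lem. D.1 (2)–(3) p. 125, Lem. D.2 (2) p. 127.
* [GelbartRogawski1991] S. Gelbart, J. Rogawski, Invent. Math. 105 (1991), §3.1 Prop. 3.1.1 p. 455; Remark p. 457.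
* [BorelWallach2000] A. Borel, N. Wallach, 2nd ed. (2000), VII 2.10, 3.2.  [BorelJacquet1979] A. Borel, H. Jacquet, PSPM 33.1 (1979), §4.1, §4.2, §4.6.
* [KonnoKonno2007] T. Konno, K. Konno, Kyushu J. Math. 61 (2007), Thm 5.4.  [PlatonovRapinchuk1994] V. Platonov, A. Rapinchuk (1994), §2.3, §5.1.
-/

set_option autoImplicit false
-- the mandated namespace repeats the single-problem summit's segment (`HodgeConjecture.HodgeConjecture`)
set_option linter.dupNamespace false

noncomputable section

namespace Summit.HodgeConjecture.HodgeConjecture.Cruxes.H413.K2E2OrAntiholWitnessOfNeg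

/-! ## §7 The socket, token for token -/

section Socket

open Summit.HodgeConjecture.HodgeConjecture.Cruxes.H413.K2E2ThetaOccursInGenAntihol (thetaOccursInGenAntihol_of_not_mem)

open scoped TensorProduct Matrix ComplexOrder
open NumberField NumberField.InfinitePlace IsDedekindDomain MeasureTheory
open Literature.NumberTheory Literature.NumberTheory.Automorphic Literature.NumberTheory.Automorphic.UnitaryGroup
open Literature.NumberTheory.Automorphic.UnitaryGroup.CotangentForms
open Literature.NumberTheory.Automorphic.Liu2021
open Literature.NumberTheory.Automorphic.Liu2021.Def411WeilCarriers
open Literature.NumberTheory.Automorphic.Liu2021.Def411WeilCarriersDoubling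
open Literature.NumberTheory.Automorphic.IdeleClassGroup
open Literature.NumberTheory.GelbartRogawski1991 Literature.NumberTheory.GelbartRogawski1991.UnitaryDualPair
open Literature.NumberTheory.GelbartRogawski1991.UnitaryDualPair.WeilCoinv
open Literature.RepresentationTheory Literature.RepresentationTheory.Liu2021
open Literature.AlgebraicGeometry.Liu2021 (IsAdmissibleElement)
open Summit.HodgeConjecture.CorCM
open Summit.HodgeConjecture.CorCM.Transposition


open Literature.NumberTheory.Automorphic.UnitaryGroup.CotangentForms (cmArchSection cmCompactFactor)
open Summit.HodgeConjecture.HodgeConjecture.Cruxes.H413.K2E2OccOrientedOfOccursIn (exists_isAntiholCotangentAt_hasFinComponent_of_occursIn_antihol_cm)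

set_option synthInstance.maxHeartbeats 400000 in
set_option maxHeartbeats 16000000 in
-- heartbeats: the socket's statement elaborates the χ-attached splitting datum twice (same budget as the socket module `…_Orient.lean`).
/-- **PAYMENT OF `sig_K2E2OrAntiholWitnessOfNeg`** (socket #18 = OR-2 of unit ORIENT of the K2_E2 road, `Cruxes/H413/Lines/K2_E2_ThetaExhaustionByRigidity_Orient.lean`,
= tier-0 `StubAntiholWitnessOfNeg`, TOKEN FOR TOKEN).
**A negatively oriented admissible weight-one label has an antiholomorphic-cotangent discrete carrier.**  At a CM frame `(L, ι, H, T)` with rational frame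
`(e₁, dV, g, ιV)` (and pinned `ιA`, unused), an automorphic measure `μA`, `μ` conjugate-symplectic of weight one with `ι ∉ Φ_μ`, and a line `a` with `a·(2δ_L)⁻¹`
`Φ_μ`-admissible: the collection hypothesis of Θ-OCC-GEN holds with `e := a·(2δ_L)⁻¹` (★ `epsOf_algebraMap_mul`: `epsOf (2δ)⁻¹ (a·(2δ)⁻¹) = locF a`), §6 gives a
non-zero `ρ(a,χ)`-equivariant `θ` from `ω_H(μ,a,χ)[ιV]` into the ANTIHOLOMORPHIC cotangent forms at `(cmArchSection T, cmCompactFactor T)`, `ρ(a,χ)` is irreducible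
(★ `F0P2cStubCI.rhoAtLine_chi_isIrreducible`, [Liu2021, Lem. D.1]), and ★ K2E2-p12 `exists_isAntiholCotangentAt_hasFinComponent_of_occursIn_antihol_cm` ((D̄) ★
`antiholCotFormSpectralProjection_of_hol` + J1′, at the GIVEN measure `μA`) produces the discrete automorphic `P″` — `IsAntiholCotangentAt` with `HasFinComponent ρ(a,χ)`.
[cite: Liu2021, proof of Prop. 4.13 Case 1 (l. 2129–2137) and «Conversely» (l. 2145–2149); App. D Lem. D.1 (2), Lem. D.2 (2)] [cite: BorelJacquet1979, §4.6]
[cite: BorelWallach2000, VII 2.10, 3.2] -/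

theorem orAntiholWitnessOfNeg :
    ∀ (L : Type) [Field L] [NumberField L] [IsCMField L] (ι : L →+* ℂ) (H : Matrix (Fin 3) (Fin 3) L) (T : GL (Fin 3) ℂ)
      (hT : (T : Matrix (Fin 3) (Fin 3) ℂ)ᴴ * H.map ι * (T : Matrix (Fin 3) (Fin 3) ℂ) = Literature.Geometry.ComplexHyperbolic.BallModel.J),
      (∀ τ' : L →+* ℂ, InfinitePlace.mk τ' ≠ InfinitePlace.mk ι → (H.map τ').PosDef) → 2 ≤ Module.finrank ℚ ↥(maximalRealSubfield L) →
      ∀ {n' : ℕ} (e₁ : Fin 3 × Fin 1 ≃ Fin n') (dV : Fin 3 → L) (hdV : ∀ i, IsCMField.complexConj L (dV i) = dV i)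
        (hdV0 : ∀ i, dV i ≠ 0) (g : GL (Fin 3) L)
        (hg : ((g : Matrix (Fin 3) (Fin 3) L).map (cmConjRingHom L))ᵀ * H * (g : Matrix (Fin 3) (Fin 3) L) = Matrix.diagonal dV)
        (ιA : (adelicGroupData (↥(maximalRealSubfield L)) L (IsCMField.complexConj L) 3 H).Adelic →*
            ↥(UnitaryGroup.adelic (↥(maximalRealSubfield L)) L (IsCMField.complexConj L) 3 (Matrix.diagonal dV))),
          (∀ k, ((ιA k : ↥(UnitaryGroup.adelic (↥(maximalRealSubfield L)) L (IsCMField.complexConj L) 3 (Matrix.diagonal dV))) :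
                GL (Fin 3) (AdeleRing (𝓞 L) L)) =
              (toAdeleGL L g)⁻¹ * adelicVal (↥(maximalRealSubfield L)) L (IsCMField.complexConj L) 3 H k * toAdeleGL L g) →
        ∀ (ιV : finAdelic (↥(maximalRealSubfield L)) L (IsCMField.complexConj L) 3 H →*
            finAdelic (↥(maximalRealSubfield L)) L (IsCMField.complexConj L) 3 (Matrix.diagonal dV)),
          (∀ k, ((ιV k : finAdelic (↥(maximalRealSubfield L)) L (IsCMField.complexConj L) 3 (Matrix.diagonal dV)) :
              GL (Fin 3) (FiniteAdeleRing (𝓞 L) L)) =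
            (toFinAdeleGL L 3 g)⁻¹ * (k : GL (Fin 3) (FiniteAdeleRing (𝓞 L) L)) * toFinAdeleGL L 3 g) →
        ∀ [CompactSpace (↥(UnitaryGroup.adelic (↥(maximalRealSubfield L)) L (IsCMField.complexConj L) 3 (Matrix.diagonal dV)) ⧸
            (UnitaryGroup.toAdelic (↥(maximalRealSubfield L)) L (IsCMField.complexConj L) 3 (Matrix.diagonal dV)).range)],
        ∀ (μA : Measure (adelicGroupData (↥(maximalRealSubfield L)) L (IsCMField.complexConj L) 3 H).automorphicQuotient)
          [(adelicGroupData (↥(maximalRealSubfield L)) L (IsCMField.complexConj L) 3 H).IsAutomorphicMeasure μA]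
          (μ : Literature.NumberTheory.Automorphic.IdeleClassGroup L →ₜ* Circle) (hμ : IsConjugateSymplectic L μ), HasWeight L μ 1 →
            ι ∉ hμ.cmType.1 →
            ∀ (a : (↥(maximalRealSubfield L))ˣ) (χ : Chi (↥(maximalRealSubfield L)) L (IsCMField.complexConj L)),
              IsAdmissibleElement L hμ.cmType.1 (algebraMap (↥(maximalRealSubfield L)) L a * (2 * imagUnit L)⁻¹) →
              ∃ P'' : DiscreteAutomorphicRep (adelicGroupData (↥(maximalRealSubfield L)) L (IsCMField.complexConj L) 3 H) μA,
                P''.IsAntiholCotangentAt (cmArchSection L ι H T hT) (cmCompactFactor L ι H T hT) ∧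
                P''.HasFinComponent
                  (rhoAtLine (↥(maximalRealSubfield L)) L (IsCMField.complexConj L) 3 e₁ (Matrix.diagonal dV)
                  (complexConj_imagUnit L) (imagUnit_ne_zero L) (imagUnit_mul_self L) (realDiagonal_isSymm L dV hdV)
                  (isUnit_det_realDiagonal L dV hdV hdV0) (realDiagonal_map L dV hdV).symm
                  (fun a => isCompatible_chiSplittingLine L e₁ dV hdV hdV0 (toHeckeCharacter L μ)
                    (isUnitary_toHeckeCharacter L μ) ((isOscillatorChar_toHeckeCharacter_iff μ).mpr hμ)
                    (TW (↥(maximalRealSubfield L)) a) (isSymm_TW (↥(maximalRealSubfield L)) a)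
                    (isUnit_det_TW (↥(maximalRealSubfield L)) a) (JW (↥(maximalRealSubfield L)) L a)
                    (JW_eq (↥(maximalRealSubfield L)) L a)) ιV a χ) := by

  intro L _ _ _ ι H T hT hpos h2 n' e₁ dV hdV hdV0 g hg ιA _ ιV hιV _ μA _ μ hμ hw hι a χ hadm
  -- the collection hypothesis of Θ-OCC-GEN from the admissibility of `a·(2δ_L)⁻¹`
  have hδ : (2 * imagUnit L)⁻¹ ≠ 0 := inv_ne_zero (mul_ne_zero two_ne_zero (imagUnit_ne_zero L))
  have hadm' : ∃ e : L, IsAdmissibleElement L hμ.cmType.1 e ∧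
      epsOf (↥(maximalRealSubfield L)) (imagUnitSq L) L (2 * imagUnit L)⁻¹ e = locF (↥(maximalRealSubfield L)) (imagUnitSq L) a :=
    ⟨_, hadm, epsOf_algebraMap_mul (↥(maximalRealSubfield L)) (imagUnitSq L) L (2 * imagUnit L)⁻¹ hδ a⟩
  -- file 3∕4 §6: the antiholomorphic occurrence of `ρ(a,χ)` at the frame
  obtain ⟨θ, hθ0, hθA, hθσ⟩ := thetaOccursInGenAntihol_of_not_mem L ι H T hT hpos h2 e₁ dV hdV hdV0 g hg ιV hιV μ hμ hw a χ hadm' hι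
  -- `ρ(a,χ)` is irreducible ([Liu2021, Lem. D.1]) and the antiholomorphic receiver of ★ K2E2-p12 at the given measure
  have hirr := F0P2cStubCI.rhoAtLine_chi_isIrreducible L H e₁ dV hdV hdV0 g hg ιV hιV μ hμ a χ
  exact exists_isAntiholCotangentAt_hasFinComponent_of_occursIn_antihol_cm L ι H T hT hpos h2 μA _ hirr θ hθ0 hθA hθσ

end Socket

end Summit.HodgeConjecture.HodgeConjecture.Cruxes.H413.K2E2OrAntiholWitnessOfNeg

end
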